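import Summits.BirchSwinnertonDyer.BirchSwinnertonDyer.Theorems.SignedLowerHalvesSmallImageLowerHalfBothSignsRttJunctionFrobenius
import Literature.NumberTheory.EllipticCurves.ZpExtensionUnramifiedProofs
import Literature.NumberTheory.Automorphic.AdicCompletionResidueCard
import HarnessLib

/-!
# Route `SignedLowerHalves`, crux L `SmallImageLowerHalfBothSigns` (stmt-BirchSwinnertonDyer-23599), line `rtt_w3` v22 — E2, junction row J2⁺ / stub S1
# (THE LOCAL PACKAGE, ramified half (L2)): AT A PLACE `w ∤ p` WHERE `θ′` IS RAMIFIED, `(ζ₀ − 1)²` KILLS THE LOCALISATION OF EVERY LEVEL CLASS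

INPUTS hand `bsd-inputs-honda-p1` g26 under LEAD `cruxlead-stmt-BirchSwinnertonDyer-23599` g12 (cell `bsd-ssimc`; v22 stub `stub_junctionLocal_ns` = S1, BRIEF-E2 rev 6 §1 (L2));
helper `--supports stmt-BirchSwinnertonDyer-23599`. THEOREMS ONLY: no definition, no named fact, no instance, no `sorry`. HONEST FRAMING: local Galois bookkeeping at the
places of `S₀K ∩ supp(p𝔣)`; E2, crux L, crux M and BSD remain OPEN and are proved for NO curve.

MATHEMATICS. `F := K_w` (`w ∤ p`), `I_F = absInertia F` with wild part `P_F` (pro-`ℓ`, `ℓ ≠ p`), `τ₀ ∈ I_F`, `ζ₀ := θ′(res τ₀)`. On `X_k = 𝒪 ⊗ μ_{p^k} ⊗ θ′` inertia acts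
through `θ′` alone (§1). For the cocycle `f` on `U_{n,w} ⊇ I_F` of the localisation of a level class: (a) `f` kills `P_F ∩ ker θ′` (pro-`ℓ` into a `p`-group); (b)–(c) on `I_F`,
`(ζ₀−1) f(σ) = (σ−1) f(τ₀)` (the commutator `[τ₀, σ]` lies in `P_F ∩ ker θ′`); (d) conjugating `τ₀` by any `g ∈ U_{n,w}`: **`(ζ₀−1)² f = ∂((ζ₀−1) f(τ₀))`** (Sah's trick), so
`loc_w ((ζ₀−1)² • y) = 0` for EVERY level class `y` (§2 `locNK_cycLayerScalarO_sub_one_sq_eq_zero`). §3 (glue, frame vocabulary): with `ζ₀ ≠ 1` (clause (R) of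
`CharRoadFrameSupp`, transported to `I_F`) and `ζ₀^m = 1` (`hθfin` + `hker`), `(ζ₀−1)² ∣ m²`, so `loc_w (m² • y) = 0` (`locNK_cycLayerScalarO_natCast_sq_eq_zero_of_ramified`):
the ramified local components are bounded torsion absorbed by the constant `m²` of S1's depletion `E := m²·∏ P_w`. References: [SerreLocalFields1979] IV §2, VII §5;
[SerreInventiones1972] §1.3, §1.8; [NeukirchSchmidtWingberg2008] (7.1.8), (8.6.2); [Rubin2000] App. B.2–B.3; [PerrinRiou1994Invent] §1.3.
-/

set_option autoImplicit false
set_option linter.dupNamespace false -- D-0017: single-problem summit, the namespace repeats the problem name by design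
noncomputable section
open scoped Classical
open NumberField IsDedekindDomain Field PowerSeries ValuativeRel

namespace Summit.BirchSwinnertonDyer.BirchSwinnertonDyer.Theorems.SmallImageRttJunctionLocal

open Literature.NumberTheory.EllipticCurves Literature.NumberTheory.GaloisRepresentations Literature.NumberTheory.GaloisRepresentations.DiscreteGaloisModule
  Literature.NumberTheory.ComplexMultiplication.EllipticUnits Literature.NumberTheory.ComplexMultiplication.EllipticUnits.JohnsonLeungKings2011
  Summit.BirchSwinnertonDyer.BirchSwinnertonDyer.Theorems.SmallImageRttD2J1 Summit.BirchSwinnertonDyer.BirchSwinnertonDyer.Theorems.SmallImageRttD2Seq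
  IsDedekindDomain.HeightOneSpectrum

/-! ## §1. Scalars on `𝒪 ⊗ μ_{p^k}` and the action of local inertia -/

section Inertia

variable {K : Type} [Field K] [NumberField K] {p : ℕ} [Fact p.Prime] (S : Set (PadicAlgCl p))
  (θ : absoluteGaloisGroup K →ₜ* (padicCoeffIntegers S)ˣ)

omit [NumberField K] in
/-- `(c − 1) ⊗ id = c ⊗ id − id` on `𝒪 ⊗ μ_n`. [cite: JohnsonLeungKings2011, §4.2 (arXiv p0012:L72–76)] -/
theorem oMuScalar_sub_one_scalar (n : ℕ) (c : padicCoeffIntegers S) (x : OMuCarrier K S n) :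
    oMuScalar S n (c - 1) x = oMuScalar S n c x - x := by
  have h := oMuScalar_add S n (c - 1) 1 x
  rw [sub_add_cancel, oMuScalar_one] at h
  exact eq_sub_of_add_eq h.symm

omit [NumberField K] in
/-- **An integer prime to `p` acts injectively on the `p^k`-torsion group `𝒪 ⊗ μ_{p^k}`** (Bézout). [cite: Lang1990, Ch. 5 §1] -/
theorem OMuCarrier.eq_zero_of_nsmul_eq_zero_of_coprime (k : ℕ) {m : ℕ} (hm : m.Coprime p) (x : OMuCarrier K S (p ^ k)) (hx : m • x = 0) : x = 0 := by
  have hc : m.Coprime (p ^ k) := Nat.Coprime.pow_right k hm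
  have hb := Nat.gcd_eq_gcd_ab m (p ^ k)
  rw [Nat.Coprime.gcd_eq_one hc] at hb
  have h1 : ((m : ℤ) * Nat.gcdA m (p ^ k) + ((p : ℤ) ^ k) * Nat.gcdB m (p ^ k)) • x = x := by
    rw [show ((m : ℤ) * Nat.gcdA m (p ^ k) + ((p : ℤ) ^ k) * Nat.gcdB m (p ^ k)) = 1 by push_cast at hb; linear_combination -hb, one_smul]
  rw [← h1, add_smul, mul_comm (m : ℤ), mul_smul, natCast_zsmul, hx, smul_zero, zero_add, mul_comm, mul_smul, OMuCarrier.pow_smul_eq_zero S k,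
    smul_zero]

/-- ★ **Local inertia at `w ∤ p` fixes `μ_{p^k}(K̄)`** (through the chosen embedding `K̄ → K̄_w`: the roots of unity of order prime to the residue characteristic are fixed by
`I_{K_w}`, tree `smul_eq_self_of_pow_eq_one_of_mem_absInertia`). [cite: SerreInventiones1972, §1.3] [cite: SerreLocalFields1979, IV §4 Prop. 16] -/
theorem mu_resGalOfEmb_eq_self_of_mem_absInertia {w : HeightOneSpectrum (𝓞 K)} (hwp : ((p : ℕ) : 𝓞 K) ∉ w.asIdeal) (k : ℕ)
    {σ : absoluteGaloisGroup (w.adicCompletion K)} (hσ : σ ∈ absInertia (w.adicCompletion K)) (v : MuCarrier K (p ^ k)) :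
    mu K (p ^ k) (resGalOfEmb (closureEmb (K := K) (w.adicCompletion K)) σ) v = v := by
  apply muVal_injective K (p ^ k)
  rw [muVal_apply]
  ext
  rw [Units.coe_smul]
  have hpk : ¬ ringChar (IsLocalRing.ResidueField 𝒪[w.adicCompletion K]) ∣ p ^ k := fun h ↦
    w.ringChar_residueField_adicCompletion_ne hwp
      (((Nat.prime_dvd_prime_iff_eq ringChar_residueField_prime (Fact.out : p.Prime)).mp (ringChar_residueField_prime.dvd_of_dvd_pow h)))
  have hζ : (closureEmb (K := K) (w.adicCompletion K) ((muVal K (p ^ k) v : (AlgebraicClosure K)ˣ) : AlgebraicClosure K)) ^ p ^ k = 1 := by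
    rw [← map_pow, ← Units.val_pow_eq_pow_val, muVal_pow_eq_one, Units.val_one, map_one]
  have h := smul_eq_self_of_pow_eq_one_of_mem_absInertia hσ (pow_pos (Fact.out : p.Prime).pos k) hpk hζ
  have h' : closureEmb (K := K) (w.adicCompletion K)
      ((resGalOfEmb (closureEmb (K := K) (w.adicCompletion K)) σ) • ((muVal K (p ^ k) v : (AlgebraicClosure K)ˣ) : AlgebraicClosure K)) =
      closureEmb (K := K) (w.adicCompletion K) ((muVal K (p ^ k) v : (AlgebraicClosure K)ˣ) : AlgebraicClosure K) := by
    rw [resGalOfEmb_apply]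
    exact (apply_resGalAuxOfEmb_apply (closureEmb (K := K) (w.adicCompletion K)) σ _).trans h
  exact (closureEmb (K := K) (w.adicCompletion K)).injective h'

/-- ★ **Local inertia at `w ∤ p` acts on `𝒪 ⊗ μ_{p^k} ⊗ θ` through `θ` alone**: `σ · x = θ(res σ) x` for `σ ∈ I_{K_w}`.
[cite: JohnsonLeungKings2011, Def. 1.1, §4.2] [cite: SerreInventiones1972, §1.3] -/
theorem muTwistO_resGalOfEmb_of_mem_absInertia {w : HeightOneSpectrum (𝓞 K)} (hwp : ((p : ℕ) : 𝓞 K) ∉ w.asIdeal) (k : ℕ)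
    {σ : absoluteGaloisGroup (w.adicCompletion K)} (hσ : σ ∈ absInertia (w.adicCompletion K)) (x : OMuCarrier K S (p ^ k)) :
    muTwistO S θ k (resGalOfEmb (closureEmb (K := K) (w.adicCompletion K)) σ) x =
      oMuScalar S (p ^ k) ((θ (resGalOfEmb (closureEmb (K := K) (w.adicCompletion K)) σ) : (padicCoeffIntegers S)ˣ) : padicCoeffIntegers S) x := by
  induction x using OMuCarrier.induction_on with
  | zero => rw [map_zero, map_zero]
  | tmul a v => rw [muTwistO_tmul, oMuScalar_tmul, mu_resGalOfEmb_eq_self_of_mem_absInertia hwp k hσ]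
  | add x y hx hy => rw [map_add, map_add, hx, hy]

end Inertia

/-! ## §2. At a ramified place off `p`, `(θ′(τ₀) − 1)²` kills the localisation of every level class -/

section Ramified

variable {K : Type} [Field K] [NumberField K] {p : ℕ} [Fact p.Prime] (S : Set (PadicAlgCl p)) (κ : ZpExtension K p)
  (θ' : absoluteGaloisGroup K →ₜ* (padicCoeffIntegers S)ˣ) (P : Set (HeightOneSpectrum (𝓞 K))) (w : HeightOneSpectrum (𝓞 K))

/-- **Local inertia lies in every local layer group `U_{n,w}`** at `w ∤ p`: `res(I_{K_w}) = I_{𝔓₀} ≤ ker κ ≤ U_n` (`ℤ_p`-extensions are unramified outside `p`,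
tree `ZpExtension.inertia_le_kerSubgroup_holds`; `I_{𝔓₀} = res(I_{K_w})`, tree `inertia_adicCompletionPrime_eq_map_absInertia`). [cite: Washington1997, Prop. 13.2] [cite: NeukirchANT1999, II §9 Prop. (9.6)] -/
theorem mem_localSubgroupOfEmb_of_mem_absInertia (hwp : ((p : ℕ) : 𝓞 K) ∉ w.asIdeal) (n : ℕ) {σ : absoluteGaloisGroup (w.adicCompletion K)}
    (hσ : σ ∈ absInertia (w.adicCompletion K)) : σ ∈ localSubgroupOfEmb (κ.layerSubgroup n) (closureEmb (K := K) (w.adicCompletion K)) := by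
  rw [mem_localSubgroupOfEmb_iff]
  refine κ.kerSubgroup_le_layerSubgroup n (ZpExtension.inertia_le_kerSubgroup_holds K p κ hwp (adicCompletionPrime_mem_primesAbove K w) ?_)
  rw [inertia_adicCompletionPrime_eq_map_absInertia]
  exact ⟨σ, hσ, rfl⟩

set_option maxHeartbeats 1600000 in
/-- ★★★ **At a place `w ∤ p`, for every `τ₀` in the local inertia group, `(θ′(τ₀) − 1)²` kills the localisation at `w` of EVERY class of `H¹(G_P(K_n), X_k)`** (so at a
`θ′`-RAMIFIED `w`, choosing `τ₀` with `θ′(τ₀) ≠ 1` of finite order, a bounded power of `p` does): the cocycle `f` of the localised class on `U_{n,w} ⊇ I_{K_w}` kills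
`P_{K_w} ∩ ker θ′` (pro-`ℓ` into a `p`-group); on `I_{K_w}`, `(ζ₀−1) f(σ) = (σ−1) f(τ₀)` (the commutator `[τ₀, σ]` is wild with `θ′ = 1`); and conjugating `τ₀` by any
`g ∈ U_{n,w}` (`I_{K_w}` is normal, `τ₀` acts as the scalar `ζ₀`) gives `(ζ₀−1)² f = ∂((ζ₀−1) f(τ₀))`, a coboundary (Sah's trick).
[cite: SerreLocalFields1979, IV §2 Cor. 1–3 of Prop. 7, VII §5] [cite: SerreInventiones1972, §1.3, §1.8] [cite: NeukirchSchmidtWingberg2008, (7.1.8)] [cite: Rubin2000, App. B.2] -/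
theorem locNK_cycLayerScalarO_sub_one_sq_eq_zero (hwp : ((p : ℕ) : 𝓞 K) ∉ w.asIdeal) {ϖ : 𝒪[w.adicCompletion K]} (hϖ : Irreducible ϖ)
    {τ₀ : absoluteGaloisGroup (w.adicCompletion K)} (hτ₀ : τ₀ ∈ absInertia (w.adicCompletion K)) (n k : ℕ) (y : cycLayerCohO S κ θ' P n k 1) :
    locNK S κ θ' P w n k (cycLayerScalarO S κ θ' P n k 1
      ((((θ' (resGalOfEmb (closureEmb (K := K) (w.adicCompletion K)) τ₀) : (padicCoeffIntegers S)ˣ) : padicCoeffIntegers S) - 1) ^ 2) y) = 0 := by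
  haveI : (imGS P (κ.layerSubgroup n)).Normal := normal_imGS P _
  haveI hIn : (absInertia (w.adicCompletion K)).Normal := absInertia_normal_holds (w.adicCompletion K)
  obtain ⟨c, rfl⟩ := oneCocycleClass_surjective (subgroupRep (coeffGSO S P θ' k).toTopRep (imGS P (κ.layerSubgroup n))) y
  obtain ⟨t, ht⟩ : ∃ t : padicCoeffIntegers S, t = ((θ' (resGalOfEmb (closureEmb (K := K) (w.adicCompletion K)) τ₀) : (padicCoeffIntegers S)ˣ) :
    padicCoeffIntegers S) := ⟨_, rfl⟩
  rw [← ht]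
  have memU : ∀ {σ : absoluteGaloisGroup (w.adicCompletion K)}, σ ∈ absInertia (w.adicCompletion K) →
      σ ∈ localSubgroupOfEmb (κ.layerSubgroup n) (closureEmb (K := K) (w.adicCompletion K)) := fun hσ ↦
    mem_localSubgroupOfEmb_of_mem_absInertia κ w hwp n hσ
  -- the value function of the localised cocycle and its cocycle identity
  obtain ⟨f, hf⟩ : ∃ f : localSubgroupOfEmb (κ.layerSubgroup n) (closureEmb (K := K) (w.adicCompletion K)) → OMuCarrier K S (p ^ k),
      ∀ x, f x = ((c.1 (locLayerHom κ P w n x) : _) : OMuCarrier K S (p ^ k)) := ⟨_, fun _ ↦ rfl⟩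
  have hf_mul : ∀ x x' : localSubgroupOfEmb (κ.layerSubgroup n) (closureEmb (K := K) (w.adicCompletion K)),
      f (x * x') = f x + muTwistO S θ' k (resGalOfEmb (closureEmb (K := K) (w.adicCompletion K)) x) (f x') := by
    intro x x'
    have h2 := c.2 (locLayerHom κ P w n x) (locLayerHom κ P w n x')
    rw [← map_mul] at h2; rw [hf, hf, hf, h2]; rfl
  -- inertia acts through `θ′`
  have hρI : ∀ {σ : absoluteGaloisGroup (w.adicCompletion K)} (hσ : σ ∈ absInertia (w.adicCompletion K)) (m : OMuCarrier K S (p ^ k)),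
      muTwistO S θ' k (resGalOfEmb (closureEmb (K := K) (w.adicCompletion K)) σ) m =
        oMuScalar S (p ^ k) ((θ' (resGalOfEmb (closureEmb (K := K) (w.adicCompletion K)) σ) : (padicCoeffIntegers S)ˣ) : padicCoeffIntegers S) m :=
    fun hσ m ↦ muTwistO_resGalOfEmb_of_mem_absInertia S θ' hwp k hσ m
  have hf1 : f 1 = 0 := by
    rw [hf, show locLayerHom κ P w n 1 = 1 from map_one _, contOneCocycles.apply_one]
    rfl
  have hf_pow : ∀ (x : localSubgroupOfEmb (κ.layerSubgroup n) (closureEmb (K := K) (w.adicCompletion K))),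
      (∀ m : OMuCarrier K S (p ^ k), muTwistO S θ' k (resGalOfEmb (closureEmb (K := K) (w.adicCompletion K)) x) m = m) →
      ∀ j : ℕ, f (x ^ j) = j • f x := by
    intro x hx j
    induction j with
    | zero => exact ((congrArg f (pow_zero x)).trans hf1).trans (zero_nsmul (f x)).symm
    | succ j ih =>
      calc f (x ^ (j + 1)) = f (x * x ^ j) := congrArg f (pow_succ' x j)
        _ = f x + muTwistO S θ' k (resGalOfEmb (closureEmb (K := K) (w.adicCompletion K)) x) (f (x ^ j)) := hf_mul x (x ^ j)
        _ = (j + 1) • f x := by rw [hx (f (x ^ j)), ih, succ_nsmul, add_comm]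
  -- (a) `f` kills the wild inertia elements on which `θ′` is trivial
  have hPa : ∀ {σ : absoluteGaloisGroup (w.adicCompletion K)} (hσP : σ ∈ absWildInertia (w.adicCompletion K) ϖ)
      (hθσ : θ' (resGalOfEmb (closureEmb (K := K) (w.adicCompletion K)) σ) = 1),
      f ⟨σ, memU (absWildInertia_le_absInertia _ ϖ hσP)⟩ = 0 := by
    intro σ hσP hθσ
    have hσI := absWildInertia_le_absInertia _ ϖ hσP
    have key : ∀ z z' : imGS P (κ.layerSubgroup n), (z : GaloisGroupUnramifiedOutside K P) = z' → c.1 z = c.1 z' := fun z z' h ↦ by rw [Subtype.ext h]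
    have hcontK : Continuous fun u : κ.layerSubgroup n ↦ c.1 ⟨toUnramifiedQuot K P u, Subgroup.mem_map_of_mem _ u.2⟩ :=
      c.1.continuous.comp (((continuous_toUnramifiedQuot K P).comp continuous_subtype_val).subtype_mk _)
    have hOopen : IsOpen (Subtype.val '' ((fun u : κ.layerSubgroup n ↦ c.1 ⟨toUnramifiedQuot K P u, Subgroup.mem_map_of_mem _ u.2⟩) ⁻¹' {0})) :=
      (κ.isOpen_layerSubgroup n).isOpenMap_subtype_val _ (hcontK.isOpen_preimage _ (isOpen_discrete _))
    have hO1 : (1 : absoluteGaloisGroup K) ∈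
        Subtype.val '' ((fun u : κ.layerSubgroup n ↦ c.1 ⟨toUnramifiedQuot K P u, Subgroup.mem_map_of_mem _ u.2⟩) ⁻¹' {0}) := by
      refine ⟨1, ?_, rfl⟩
      rw [Set.mem_preimage, Set.mem_singleton_iff, show (⟨toUnramifiedQuot K P ((1 : κ.layerSubgroup n) : absoluteGaloisGroup K),
        Subgroup.mem_map_of_mem _ (1 : κ.layerSubgroup n).2⟩ : imGS P (κ.layerSubgroup n)) = 1 from Subtype.ext (map_one _)]
      exact contOneCocycles.apply_one c
    obtain ⟨V, hV⟩ := ProfiniteGrp.exist_openNormalSubgroup_sub_open_nhds_of_one hOopen hO1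
    have hNopen : IsOpen ((((V : Subgroup (absoluteGaloisGroup K)).comap (resGalOfEmb (closureEmb (K := K) (w.adicCompletion K))).toMonoidHom :
        Subgroup (absoluteGaloisGroup (w.adicCompletion K))) : Set (absoluteGaloisGroup (w.adicCompletion K)))) :=
      V.isOpen.preimage (resGalOfEmb (closureEmb (K := K) (w.adicCompletion K))).continuous
    obtain ⟨a, ha⟩ := absWildInertia_isProP_holds (w.adicCompletion K) hϖ hσP _ hNopen
    rw [Subgroup.mem_comap] at ha
    obtain ⟨u', hu', hu'eq⟩ := hV ha
    rw [Set.mem_preimage, Set.mem_singleton_iff] at hu'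
    have hz : ((locLayerHom κ P w n (⟨σ, memU hσI⟩ ^ (ringChar (IsLocalRing.ResidueField 𝒪[w.adicCompletion K]) ^ a)) :
        imGS P (κ.layerSubgroup n)) : GaloisGroupUnramifiedOutside K P) =
        ((⟨toUnramifiedQuot K P u', Subgroup.mem_map_of_mem _ u'.2⟩ : imGS P (κ.layerSubgroup n)) : GaloisGroupUnramifiedOutside K P) := by
      rw [locLayerHom_apply_coe, locGS_apply, Subgroup.coe_pow]
      exact (congrArg (toUnramifiedQuot K P) hu'eq).symm
    have hval : f (⟨σ, memU hσI⟩ ^ (ringChar (IsLocalRing.ResidueField 𝒪[w.adicCompletion K]) ^ a)) = 0 := by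
      rw [hf, key _ _ hz, hu']
      rfl
    rw [hf_pow _ (fun m ↦ by rw [hρI hσI, hθσ, Units.val_one, oMuScalar_one]) _] at hval
    refine OMuCarrier.eq_zero_of_nsmul_eq_zero_of_coprime S k ?_ _ hval
    exact Nat.Coprime.pow_left a ((Nat.coprime_primes ringChar_residueField_prime (Fact.out : p.Prime)).mpr
      (w.ringChar_residueField_adicCompletion_ne hwp))
  have hR_mul : ∀ (σ τ : absoluteGaloisGroup (w.adicCompletion K)) (m : OMuCarrier K S (p ^ k)),
      muTwistO S θ' k (resGalOfEmb (closureEmb (K := K) (w.adicCompletion K)) (σ * τ)) m =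
        muTwistO S θ' k (resGalOfEmb (closureEmb (K := K) (w.adicCompletion K)) σ)
          (muTwistO S θ' k (resGalOfEmb (closureEmb (K := K) (w.adicCompletion K)) τ) m) := fun σ τ m ↦ by
    rw [map_mul, map_mul]
    rfl
  have hT_R : ∀ (σ : absoluteGaloisGroup (w.adicCompletion K)) (a : padicCoeffIntegers S) (m : OMuCarrier K S (p ^ k)),
      oMuScalar S (p ^ k) a (muTwistO S θ' k (resGalOfEmb (closureEmb (K := K) (w.adicCompletion K)) σ) m) =
        muTwistO S θ' k (resGalOfEmb (closureEmb (K := K) (w.adicCompletion K)) σ) (oMuScalar S (p ^ k) a m) := fun σ a m ↦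
    oMuScalar_muTwistO S θ' k a _ m
  have hTt : ∀ m : OMuCarrier K S (p ^ k), oMuScalar S (p ^ k) (t - 1) (oMuScalar S (p ^ k) t m) = oMuScalar S (p ^ k) t (oMuScalar S (p ^ k) (t - 1) m) :=
    fun m ↦ by rw [← oMuScalar_mul, ← oMuScalar_mul, mul_comm]
  -- (b)–(c) Sah's commutator trick on inertia: for `σ ∈ I_{K_w}`, `(t − 1) f(σ) = σ f(τ₀) − f(τ₀)` (the commutator `[τ₀, σ]` is wild with `θ′ = 1`, killed by (a))
  have hc0 : ∀ {σ : absoluteGaloisGroup (w.adicCompletion K)} (hσ : σ ∈ absInertia (w.adicCompletion K)),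
      oMuScalar S (p ^ k) (t - 1) (f ⟨σ, memU hσ⟩) =
        muTwistO S θ' k (resGalOfEmb (closureEmb (K := K) (w.adicCompletion K)) σ) (f ⟨τ₀, memU hτ₀⟩) - f ⟨τ₀, memU hτ₀⟩ := by
    intro σ hσ
    have hcP : τ₀ * σ * τ₀⁻¹ * σ⁻¹ ∈ absWildInertia (w.adicCompletion K) ϖ := commutator_mem_absWildInertia hϖ.ne_zero hτ₀ hσ
    have hcI : τ₀ * σ * τ₀⁻¹ * σ⁻¹ ∈ absInertia (w.adicCompletion K) := absWildInertia_le_absInertia _ ϖ hcP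
    have hθc : θ' (resGalOfEmb (closureEmb (K := K) (w.adicCompletion K)) (τ₀ * σ * τ₀⁻¹ * σ⁻¹)) = 1 := by
      simp only [map_mul, map_inv, mul_inv_cancel_comm, mul_inv_cancel]
    have hfc : f ⟨τ₀ * σ * τ₀⁻¹ * σ⁻¹, memU hcI⟩ = 0 := hPa hcP hθc
    have e1 : (⟨τ₀, memU hτ₀⟩ : localSubgroupOfEmb (κ.layerSubgroup n) (closureEmb (K := K) (w.adicCompletion K))) * ⟨σ, memU hσ⟩ =
        ⟨τ₀ * σ * τ₀⁻¹ * σ⁻¹, memU hcI⟩ * ⟨σ, memU hσ⟩ * ⟨τ₀, memU hτ₀⟩ :=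
      Subtype.ext (show τ₀ * σ = τ₀ * σ * τ₀⁻¹ * σ⁻¹ * σ * τ₀ by group)
    have A := hf_mul ⟨τ₀, memU hτ₀⟩ ⟨σ, memU hσ⟩
    have B := hf_mul (⟨τ₀ * σ * τ₀⁻¹ * σ⁻¹, memU hcI⟩ * ⟨σ, memU hσ⟩) ⟨τ₀, memU hτ₀⟩
    have C := hf_mul ⟨τ₀ * σ * τ₀⁻¹ * σ⁻¹, memU hcI⟩ ⟨σ, memU hσ⟩
    rw [e1, B, C, hfc, zero_add] at A
    have D1 : muTwistO S θ' k (resGalOfEmb (closureEmb (K := K) (w.adicCompletion K))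
        ((⟨τ₀ * σ * τ₀⁻¹ * σ⁻¹, memU hcI⟩ : localSubgroupOfEmb (κ.layerSubgroup n) (closureEmb (K := K) (w.adicCompletion K))) :
          absoluteGaloisGroup (w.adicCompletion K))) (f ⟨σ, memU hσ⟩) = f ⟨σ, memU hσ⟩ := by
      show muTwistO S θ' k (resGalOfEmb (closureEmb (K := K) (w.adicCompletion K)) (τ₀ * σ * τ₀⁻¹ * σ⁻¹)) (f ⟨σ, memU hσ⟩) = _
      rw [hρI hcI, hθc, Units.val_one, oMuScalar_one]
    have D2 : muTwistO S θ' k (resGalOfEmb (closureEmb (K := K) (w.adicCompletion K))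
        ((⟨τ₀ * σ * τ₀⁻¹ * σ⁻¹, memU hcI⟩ * ⟨σ, memU hσ⟩ : localSubgroupOfEmb (κ.layerSubgroup n) (closureEmb (K := K) (w.adicCompletion K))) :
          absoluteGaloisGroup (w.adicCompletion K))) (f ⟨τ₀, memU hτ₀⟩) =
        muTwistO S θ' k (resGalOfEmb (closureEmb (K := K) (w.adicCompletion K)) σ) (f ⟨τ₀, memU hτ₀⟩) := by
      show muTwistO S θ' k (resGalOfEmb (closureEmb (K := K) (w.adicCompletion K)) (τ₀ * σ * τ₀⁻¹ * σ⁻¹ * σ)) (f ⟨τ₀, memU hτ₀⟩) = _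
      rw [hR_mul, hρI hcI, hθc, Units.val_one, oMuScalar_one]
    have D3 : muTwistO S θ' k (resGalOfEmb (closureEmb (K := K) (w.adicCompletion K))
        ((⟨τ₀, memU hτ₀⟩ : localSubgroupOfEmb (κ.layerSubgroup n) (closureEmb (K := K) (w.adicCompletion K))) : absoluteGaloisGroup (w.adicCompletion K)))
          (f ⟨σ, memU hσ⟩) = oMuScalar S (p ^ k) t (f ⟨σ, memU hσ⟩) := by
      show muTwistO S θ' k (resGalOfEmb (closureEmb (K := K) (w.adicCompletion K)) τ₀) (f ⟨σ, memU hσ⟩) = _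
      rw [hρI hτ₀, ← ht]
    rw [D1, D2, D3] at A
    rw [oMuScalar_sub_one_scalar, sub_eq_sub_iff_add_eq_add, add_comm (oMuScalar S (p ^ k) t (f ⟨σ, memU hσ⟩)) (f ⟨τ₀, memU hτ₀⟩),
      add_comm (muTwistO S θ' k (resGalOfEmb (closureEmb (K := K) (w.adicCompletion K)) σ) (f ⟨τ₀, memU hτ₀⟩)) (f ⟨σ, memU hσ⟩)]
    exact A.symm
  -- (d) for EVERY `g ∈ U_{n,w}`: `(t − 1)² f(g) = g x₀ − x₀`, `x₀ := (t − 1) f(τ₀)` (conjugate `τ₀` by `g`: `g⁻¹ τ₀ g ∈ I_{K_w}`, and `τ₀` acts as the scalar `t`)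
  have hd : ∀ g : localSubgroupOfEmb (κ.layerSubgroup n) (closureEmb (K := K) (w.adicCompletion K)),
      oMuScalar S (p ^ k) (t - 1) (oMuScalar S (p ^ k) (t - 1) (f g)) =
        muTwistO S θ' k (resGalOfEmb (closureEmb (K := K) (w.adicCompletion K)) (g : absoluteGaloisGroup (w.adicCompletion K)))
            (oMuScalar S (p ^ k) (t - 1) (f ⟨τ₀, memU hτ₀⟩)) -
          oMuScalar S (p ^ k) (t - 1) (f ⟨τ₀, memU hτ₀⟩) := by
    intro g
    have hσ' : (g : absoluteGaloisGroup (w.adicCompletion K))⁻¹ * τ₀ * g ∈ absInertia (w.adicCompletion K) := hIn.conj_mem' τ₀ hτ₀ _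
    have e2 : (⟨τ₀, memU hτ₀⟩ : localSubgroupOfEmb (κ.layerSubgroup n) (closureEmb (K := K) (w.adicCompletion K))) * g =
        g * ⟨(g : absoluteGaloisGroup (w.adicCompletion K))⁻¹ * τ₀ * g, memU hσ'⟩ :=
      Subtype.ext (show τ₀ * (g : absoluteGaloisGroup (w.adicCompletion K)) = g * ((g : absoluteGaloisGroup (w.adicCompletion K))⁻¹ * τ₀ * g) by group)
    have e3 : (g : absoluteGaloisGroup (w.adicCompletion K)) * ((g : absoluteGaloisGroup (w.adicCompletion K))⁻¹ * τ₀ * g) = τ₀ * g := by group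
    have A := hf_mul ⟨τ₀, memU hτ₀⟩ g
    have B := hf_mul g ⟨(g : absoluteGaloisGroup (w.adicCompletion K))⁻¹ * τ₀ * g, memU hσ'⟩
    rw [e2, B] at A
    have D3 : muTwistO S θ' k (resGalOfEmb (closureEmb (K := K) (w.adicCompletion K))
        ((⟨τ₀, memU hτ₀⟩ : localSubgroupOfEmb (κ.layerSubgroup n) (closureEmb (K := K) (w.adicCompletion K))) : absoluteGaloisGroup (w.adicCompletion K)))
          (f g) = oMuScalar S (p ^ k) t (f g) := by
      show muTwistO S θ' k (resGalOfEmb (closureEmb (K := K) (w.adicCompletion K)) τ₀) (f g) = _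
      rw [hρI hτ₀, ← ht]
    rw [D3] at A
    -- `A : f g + g f(σ′) = f(τ₀) + t f(g)`; apply `t − 1` and use (c) for `σ′ = g⁻¹ τ₀ g`
    have E1 : oMuScalar S (p ^ k) (t - 1) (muTwistO S θ' k (resGalOfEmb (closureEmb (K := K) (w.adicCompletion K)) (g : absoluteGaloisGroup (w.adicCompletion K)))
        (f ⟨(g : absoluteGaloisGroup (w.adicCompletion K))⁻¹ * τ₀ * g, memU hσ'⟩)) =
        muTwistO S θ' k (resGalOfEmb (closureEmb (K := K) (w.adicCompletion K)) (g : absoluteGaloisGroup (w.adicCompletion K)))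
          (oMuScalar S (p ^ k) (t - 1) (f ⟨τ₀, memU hτ₀⟩)) := by
      rw [hT_R, hc0 hσ', map_sub, ← hR_mul, e3, hR_mul,
        hρI hτ₀ (muTwistO S θ' k (resGalOfEmb (closureEmb (K := K) (w.adicCompletion K)) (g : absoluteGaloisGroup (w.adicCompletion K))) (f ⟨τ₀, memU hτ₀⟩)),
        ← ht, ← oMuScalar_sub_one_scalar, hT_R]
    have A' := congrArg (oMuScalar S (p ^ k) (t - 1)) A
    rw [map_add, map_add, E1, hTt] at A'
    rw [oMuScalar_sub_one_scalar S (p ^ k) t (oMuScalar S (p ^ k) (t - 1) (f g)), sub_eq_sub_iff_add_eq_add,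
      add_comm (oMuScalar S (p ^ k) t (oMuScalar S (p ^ k) (t - 1) (f g))) (oMuScalar S (p ^ k) (t - 1) (f ⟨τ₀, memU hτ₀⟩)),
      add_comm (muTwistO S θ' k (resGalOfEmb (closureEmb (K := K) (w.adicCompletion K)) (g : absoluteGaloisGroup (w.adicCompletion K)))
        (oMuScalar S (p ^ k) (t - 1) (f ⟨τ₀, memU hτ₀⟩))) (oMuScalar S (p ^ k) (t - 1) (f g))]
    exact A'.symm
  -- (e) the class: `(t − 1)² · (c ∘ loc_w) = ∂x₀` on `U_{n,w}`
  rw [cycLayerScalarO_eq_map, locNK_map_id_oneCocycleClass, oneCocycleClass_eq_zero_iff]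
  refine ⟨coeffMapO S P θ' (oMuScalar S (p ^ k) (t - 1)) (oMuScalar_muTwistO S θ' k (t - 1)) (c.1 (locLayerHom κ P w n ⟨τ₀, memU hτ₀⟩)),
    fun g ↦ Subtype.ext ?_⟩
  change oMuScalar S (p ^ k) ((t - 1) ^ 2) ((c.1 (locLayerHom κ P w n g) : _) : OMuCarrier K S (p ^ k)) =
    muTwistO S θ' k (resGalOfEmb (closureEmb (K := K) (w.adicCompletion K)) (g : absoluteGaloisGroup (w.adicCompletion K)))
        (oMuScalar S (p ^ k) (t - 1) ((c.1 (locLayerHom κ P w n ⟨τ₀, memU hτ₀⟩) : _) : OMuCarrier K S (p ^ k))) -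
      oMuScalar S (p ^ k) (t - 1) ((c.1 (locLayerHom κ P w n ⟨τ₀, memU hτ₀⟩) : _) : OMuCarrier K S (p ^ k))
  rw [← hf, ← hf, sq, oMuScalar_mul]
  exact hd g

end Ramified

/-! ## §3. Glue for S1: at a `θ′`-ramified place off `p`, `m²` kills the localisation of every level class (`m` = an exponent of `θ′` on inertia) -/

section Glue

variable {K : Type} [Field K] [NumberField K] {p : ℕ} [Fact p.Prime] (S : Set (PadicAlgCl p)) (κ : ZpExtension K p)
  (θ' : absoluteGaloisGroup K →ₜ* (padicCoeffIntegers S)ˣ) (P : Set (HeightOneSpectrum (𝓞 K))) (w : HeightOneSpectrum (𝓞 K))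

/-- Divisibility transfer: if `a ∣ b` and `loc_w (a • y) = 0` then `loc_w (b • y) = 0` (`loc_w` commutes with the `𝒪`-scalars, which are multiplicative).
[cite: JohnsonLeungKings2011, §4.2 (arXiv p0012:L72–76, L109–112)] -/
theorem locNK_cycLayerScalarO_eq_zero_of_dvd (n k : ℕ) {a b : padicCoeffIntegers S} (hab : a ∣ b) (y : cycLayerCohO S κ θ' P n k 1)
    (h : locNK S κ θ' P w n k (cycLayerScalarO S κ θ' P n k 1 a y) = 0) :
    locNK S κ θ' P w n k (cycLayerScalarO S κ θ' P n k 1 b y) = 0 := by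
  obtain ⟨d, rfl⟩ := hab
  rw [mul_comm, show cycLayerScalarO S κ θ' P n k 1 (d * a) y = cycLayerScalarO S κ θ' P n k 1 d (cycLayerScalarO S κ θ' P n k 1 a y) from
    levelScalarO_mul S P θ' (κ.layerSubgroup n) k 1 d a y, locNK_cycLayerScalarO, h]
  exact map_zero _

/-- In a domain, `t^m = 1` and `t ≠ 1` give `t − 1 ∣ m` (`m = −∑_{j<m} (t^j − 1)` as `∑_{j<m} t^j = 0`). [cite: Lang1990, Ch. 1 §2 (cyclotomic integers)] -/
theorem sub_one_dvd_natCast_of_pow_eq_one {R : Type*} [CommRing R] [IsDomain R] {t : R} {m : ℕ} (ht : t ^ m = 1) (ht1 : t ≠ 1) : t - 1 ∣ (m : R) := by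
  have hgeom : ∑ j ∈ Finset.range m, t ^ j = 0 := by
    have h := mul_geom_sum t m
    exact (mul_eq_zero.mp ((ht ▸ h).trans (sub_self _))).resolve_left (sub_ne_zero.mpr ht1)
  have hm : (m : R) = -∑ j ∈ Finset.range m, (t ^ j - 1) := by
    rw [Finset.sum_sub_distrib, hgeom, zero_sub, neg_neg, Finset.sum_const, Finset.card_range, nsmul_eq_mul, mul_one]
  rw [hm]
  exact (Finset.dvd_sum fun j _ ↦ sub_one_dvd_pow_sub_one t j).neg_right

/-- ★★ **`m²` kills the localisation at `w ∤ p` of every level class, for `m` an exponent of `ζ₀ = θ′(τ₀) ≠ 1`, `τ₀ ∈ I_{K_w}`** (`(ζ₀ − 1)² ∣ m²` and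
`locNK_cycLayerScalarO_sub_one_sq_eq_zero`; a uniformizer of `K_w` exists). [cite: SerreLocalFields1979, IV §2, VII §5] [cite: Rubin2000, App. B.2] -/
theorem locNK_cycLayerScalarO_natCast_sq_eq_zero (hwp : ((p : ℕ) : 𝓞 K) ∉ w.asIdeal) {τ₀ : absoluteGaloisGroup (w.adicCompletion K)}
    (hτ₀ : τ₀ ∈ absInertia (w.adicCompletion K)) {m : ℕ} (htm : θ' (resGalOfEmb (closureEmb (K := K) (w.adicCompletion K)) τ₀) ^ m = 1)
    (ht1 : θ' (resGalOfEmb (closureEmb (K := K) (w.adicCompletion K)) τ₀) ≠ 1) (n k : ℕ) (y : cycLayerCohO S κ θ' P n k 1) :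
    locNK S κ θ' P w n k (cycLayerScalarO S κ θ' P n k 1 ((m : padicCoeffIntegers S) ^ 2) y) = 0 := by
  obtain ⟨ϖ, hϖ⟩ := IsDiscreteValuationRing.exists_irreducible 𝒪[w.adicCompletion K]
  refine locNK_cycLayerScalarO_eq_zero_of_dvd S κ θ' P w n k (pow_dvd_pow_of_dvd (sub_one_dvd_natCast_of_pow_eq_one ?_ ?_) 2) y
    (locNK_cycLayerScalarO_sub_one_sq_eq_zero S κ θ' P w hwp hϖ hτ₀ n k y)
  · rw [← Units.val_pow_eq_pow_val, htm, Units.val_one]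
  · exact fun h ↦ ht1 (Units.val_eq_one.mp h)

/-- Transport of the frame's ramification clause (R) to the local inertia group: if SOME inertia element above `w` is not killed by `θ′`, then some `τ₀ ∈ I_{K_w}` has
`θ′(res τ₀) ≠ 1` (`Γ_K` permutes the primes above `w` transitively, conjugation carries inertia groups along and does not change the value of the character `θ′`, and
`I_{𝔓₀} = res(I_{K_w})`). [cite: NeukirchANT1999, I §9 Prop. (9.4), II §9 Prop. (9.6)] -/
theorem exists_mem_absInertia_apply_ne_one (hR : ∃ 𝔓 ∈ w.primesAbove, ∃ τ ∈ 𝔓.inertia (absoluteGaloisGroup K), θ' τ ≠ 1) :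
    ∃ τ₀ ∈ absInertia (w.adicCompletion K), θ' (resGalOfEmb (closureEmb (K := K) (w.adicCompletion K)) τ₀) ≠ 1 := by
  obtain ⟨𝔓, h𝔓, τ, hτ, hne⟩ := hR
  obtain ⟨g, hg⟩ := exists_smul_eq_of_mem_primesAbove_holds h𝔓 (adicCompletionPrime_mem_primesAbove K w)
  have hc : g * τ * g⁻¹ ∈ (adicCompletionPrime K w).inertia (absoluteGaloisGroup K) := hg ▸ conj_mem_inertia_smul hτ g
  rw [inertia_adicCompletionPrime_eq_map_absInertia, Subgroup.mem_map] at hc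
  obtain ⟨τ₀, hτ₀, he⟩ := hc
  refine ⟨τ₀, hτ₀, fun h1 ↦ hne ?_⟩
  have h2 : θ' (g * τ * g⁻¹) = 1 := by rw [← h1, ← he]; rfl
  rwa [map_mul, map_mul, map_inv, mul_inv_cancel_comm] at h2

/-- The frame's exponent clause on local inertia: if `θ′^m = 1` on every inertia group above `w`, then `θ′(res τ₀)^m = 1` for `τ₀ ∈ I_{K_w}`.
[cite: NeukirchANT1999, II §9 Prop. (9.6)] -/
theorem apply_resGalOfEmb_pow_eq_one_of_mem_absInertia {m : ℕ} (hθm : ∀ 𝔓 ∈ w.primesAbove, ∀ τ ∈ 𝔓.inertia (absoluteGaloisGroup K), θ' τ ^ m = 1)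
    {τ₀ : absoluteGaloisGroup (w.adicCompletion K)} (hτ₀ : τ₀ ∈ absInertia (w.adicCompletion K)) :
    θ' (resGalOfEmb (closureEmb (K := K) (w.adicCompletion K)) τ₀) ^ m = 1 := by
  refine hθm _ (adicCompletionPrime_mem_primesAbove K w) _ ?_
  rw [inertia_adicCompletionPrime_eq_map_absInertia]
  exact ⟨τ₀, hτ₀, rfl⟩

/-- ★★★ **(L2) IN THE FRAME'S VOCABULARY**: at a place `w ∤ p` RAMIFIED for `θ′` (clause (R) of `CharRoadFrameSupp`) where `θ′` has exponent `m` on inertia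
(`hθfin` + `hker`: `θ′ = χ₀` of finite order on `Gal(K̄/K_∞) ⊇ I_w`), `m²` kills the localisation at `w` of EVERY class of EVERY layer group `H¹(G_P(K_n), X_k)` — the
ramified local components are bounded torsion, absorbed by the constant of S1's depletion. [cite: PerrinRiou1994Invent, §1.3] [cite: Rubin2000, App. B.2–B.3] -/
theorem locNK_cycLayerScalarO_natCast_sq_eq_zero_of_ramified (hwp : ((p : ℕ) : 𝓞 K) ∉ w.asIdeal)
    (hR : ∃ 𝔓 ∈ w.primesAbove, ∃ τ ∈ 𝔓.inertia (absoluteGaloisGroup K), θ' τ ≠ 1)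
    {m : ℕ} (hθm : ∀ 𝔓 ∈ w.primesAbove, ∀ τ ∈ 𝔓.inertia (absoluteGaloisGroup K), θ' τ ^ m = 1) (n k : ℕ) (y : cycLayerCohO S κ θ' P n k 1) :
    locNK S κ θ' P w n k (cycLayerScalarO S κ θ' P n k 1 ((m : padicCoeffIntegers S) ^ 2) y) = 0 := by
  obtain ⟨τ₀, hτ₀, ht1⟩ := exists_mem_absInertia_apply_ne_one S θ' w hR
  exact locNK_cycLayerScalarO_natCast_sq_eq_zero S κ θ' P w hwp hτ₀ (apply_resGalOfEmb_pow_eq_one_of_mem_absInertia S θ' w hθm hτ₀) ht1 n k y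

end Glue
end Summit.BirchSwinnertonDyer.BirchSwinnertonDyer.Theorems.SmallImageRttJunctionLocal

end
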